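import Summits.PneNP.PneNP.Theorems.KarlinRubinMonotoneBlindStubBlindAndDnfPeel
import Summits.PneNP.PneNP.Theorems.KarlinRubinMonotoneBlindStubPlantingBound

/-!
# Route KarlinRubin, crux `MonotoneBlind` (stmt-PneNP-18027), line `Sketch`: stub `stub_blindAndDnf`, per-`n` bound

Probability form of the peeling count (`KarlinRubinMonotoneBlindStubBlindAndDnfPeel.lean`) for an AND of monotone
DNFs `f = ∧ᵢ Dᵢ` on the edge slots of `Kₙ` under the planted-clique pair (`G(n,1/2)` versus `G(n,1/2) ∪ K_A`, `A`
uniform in `kSubsets n k`, `d = min k n`). If `f (x ∪ K_A) = 1` but `f x = 0`, some `Dᵢ` is dead at `x` and revived by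
`A`, i.e. `A` covers the vertices of a minimal missing set of `Dᵢ` at `x` (independent of `A`):

* `erdosRenyiHalf_minimal_tail_le` — the noise points at which a DNF is dead, its wide terms miss many slots, and it has
  `≥ u` minimal missing sets of size `≤ b` have probability `≤ A₀ / u^L` (`A₀ = (2^{bL}(bL+w)+1)^{bL} 2^{bL·L}`);
* `erdosRenyiHalf_wide_le` — some term with `> W` slots misses `≤ B` slots: probability `≤ #D · N^B · 2^{-(W-B)}`;
* `uniformKSubsets_revive_le` — at a dead point with `N_b` small minimal missing sets, the revival probability over `A`
  is `≤ N_b d²/n² + #D · d^{v₀}/n^{v₀}` (`b ≥ C(v₀-1, 2)`: a missing set with `> b` slots spans `≥ v₀` vertices);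
* `andDnf_planted_le` — **per-`n` bound**: `Pr_planted[f] ≤ u d²/n² + s d^{v₀}/n^{v₀} + Pr_null[f] +
  m (A₀/u^L + s N^{bL} 2^{-w})` for `m` DNFs with `≤ s` terms each (via `stub_plantingBound`); restated as the
  registered helper stub `stub_blindAndDnfBound`.

All `--supports stmt-PneNP-18027`; no definitions.
-/

set_option linter.dupNamespace false -- `Summit.PneNP.PneNP.…` is the layout-mandated namespace (D-0017)

namespace Summit.PneNP.PneNP.Theorems.MonotoneBlind.VertexCover

open Literature.Computability.Complexity Literature.Probability.RandomGraphs.PlantedClique Finset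
open scoped ENNReal

variable {n : ℕ}

/-! ### Arithmetic and counting helpers -/

/-- `ℕ → ℝ≥0∞`: `a d ≤ c b` gives `a / b ≤ c / d` (`b, d ≠ 0`). [folklore] -/
theorem natCast_div_le_div_of_mul_le {a b c d : ℕ} (h : a * d ≤ c * b) (hb : b ≠ 0) (hd : d ≠ 0) :
    ((a : ℕ) : ℝ≥0∞) / ((b : ℕ) : ℝ≥0∞) ≤ ((c : ℕ) : ℝ≥0∞) / ((d : ℕ) : ℝ≥0∞) := by
  have hb0 : ((b : ℕ) : ℝ≥0∞) ≠ 0 := by exact_mod_cast hb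
  have hd0 : ((d : ℕ) : ℝ≥0∞) ≠ 0 := by exact_mod_cast hd
  have hbt : ((b : ℕ) : ℝ≥0∞) ≠ ⊤ := ENNReal.natCast_ne_top _
  have hdt : ((d : ℕ) : ℝ≥0∞) ≠ ⊤ := ENNReal.natCast_ne_top _
  have h1 : ((a : ℕ) : ℝ≥0∞) ≤ ((c : ℕ) : ℝ≥0∞) * b / d :=
    (ENNReal.le_div_iff_mul_le (Or.inl hd0) (Or.inl hdt)).2 (by exact_mod_cast h)
  calc ((a : ℕ) : ℝ≥0∞) / b ≤ (((c : ℕ) : ℝ≥0∞) * b / d) / b := by gcongr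
    _ = ((c : ℕ) : ℝ≥0∞) * (d : ℝ≥0∞)⁻¹ * ((b : ℝ≥0∞) * (b : ℝ≥0∞)⁻¹) := by
        simp only [div_eq_mul_inv]; ring
    _ = ((c : ℕ) : ℝ≥0∞) / d := by rw [ENNReal.mul_inv_cancel hb0 hbt, mul_one, div_eq_mul_inv]

/-- Under `G(n,1/2)` a fixed set of slots is all ON with probability `≤ 2^{-|T|}`. [folklore] -/
theorem erdosRenyiHalf_forall_eq_true_le (T : Finset (⊤ : SimpleGraph (Fin n)).edgeSet) :
    (erdosRenyiHalf n).toOuterMeasure {x | ∀ e ∈ T, x e = true} ≤ 2⁻¹ ^ #T := by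
  classical
  refine erdosRenyiHalf_le_half_pow_of_card_mul_le _ _ ?_
  have hset : (univ.filter fun x : EdgeVec n => x ∈ {x : EdgeVec n | ∀ e ∈ T, x e = true}) =
      univ.filter fun x : EdgeVec n => ∀ e ∈ T, x e = true := by
    ext x; simp
  rw [hset]
  exact card_filter_forall_eq_true_mul_le T

/-! ### The tail event: many small minimal missing sets -/

/-- **Tail probability.** The noise points `x` at which the DNF `D` is dead, every term with `> bL + w` slots misses
`> bL` slots, and there are `≥ u` minimal missing sets of size `≤ b`, have `G(n,1/2)`-probability `≤ A₀ / u^L` with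
`A₀ = (2^{bL} (bL + w) + 1)^{bL} 2^{bL·L}` (narrow to the terms with `≤ bL + w` slots, then Markov on the `L`-th moment
`pow_mul_card_minimal_ge_le`). [folklore] -/
theorem erdosRenyiHalf_minimal_tail_le (D : Finset (Finset (⊤ : SimpleGraph (Fin n)).edgeSet)) (w b L u : ℕ)
    (hL : 1 ≤ L) :
    (erdosRenyiHalf n).toOuterMeasure {x |
        (∀ E ∈ D, ¬ E ⊆ univ.filter fun e => x e = true) ∧
        (∀ E ∈ D, b * L + w < #E → b * L < #(E \ univ.filter fun e => x e = true)) ∧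
        u ≤ #((D.image fun E => E \ univ.filter fun e => x e = true).filter fun F =>
          (∀ E ∈ D, E \ (univ.filter fun e => x e = true) ⊆ F →
            E \ (univ.filter fun e => x e = true) = F) ∧ #F ≤ b)} ≤
      ((((2 ^ (b * L) * (b * L + w) + 1) ^ (b * L) * 2 ^ (b * L * L) : ℕ)) : ℝ≥0∞) / ((u ^ L : ℕ) : ℝ≥0∞) := by
  classical
  set A₀ := (2 ^ (b * L) * (b * L + w) + 1) ^ (b * L) * 2 ^ (b * L * L) with hA₀
  have hA₀pos : A₀ ≠ 0 := by positivity
  rcases Nat.eq_zero_or_pos u with hu | hu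
  · subst hu
    rw [zero_pow (by omega), Nat.cast_zero, ENNReal.div_zero (by exact_mod_cast hA₀pos)]
    exact le_top
  set D' := D.filter fun E => #E ≤ b * L + w with hD'
  set P : Finset (⊤ : SimpleGraph (Fin n)).edgeSet → Prop := fun X => (∀ E ∈ D', ¬ E ⊆ X) ∧
    u ≤ #((D'.image fun E => E \ X).filter fun F => (∀ E ∈ D', E \ X ⊆ F → E \ X = F) ∧ #F ≤ b) with hP
  set S : Set (EdgeVec n) := {x |
        (∀ E ∈ D, ¬ E ⊆ univ.filter fun e => x e = true) ∧
        (∀ E ∈ D, b * L + w < #E → b * L < #(E \ univ.filter fun e => x e = true)) ∧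
        u ≤ #((D.image fun E => E \ univ.filter fun e => x e = true).filter fun F =>
          (∀ E ∈ D, E \ (univ.filter fun e => x e = true) ⊆ F →
            E \ (univ.filter fun e => x e = true) = F) ∧ #F ≤ b)} with hS
  -- (1) the event, read on the set of `true` slots, implies `P`
  have hSP : ∀ x : EdgeVec n, x ∈ S → P (univ.filter fun e => x e = true) := by
    intro x hx
    rw [hS, Set.mem_setOf_eq] at hx
    obtain ⟨hdead, hnw, hu⟩ := hx
    have hmn : ((D.image fun E => E \ univ.filter fun e => x e = true).filter fun F =>
          (∀ E ∈ D, E \ (univ.filter fun e => x e = true) ⊆ F →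
            E \ (univ.filter fun e => x e = true) = F) ∧ #F ≤ b) ⊆
      (((D.filter fun E => #E ≤ b * L + w).image fun E => E \ univ.filter fun e => x e = true).filter fun F =>
        (∀ E ∈ D.filter (fun E => #E ≤ b * L + w), E \ (univ.filter fun e => x e = true) ⊆ F →
          E \ (univ.filter fun e => x e = true) = F) ∧ #F ≤ b) :=
      minimal_subset_minimal_narrow D (univ.filter fun e => x e = true) (b * L + w) (b * L) b
        (Nat.le_mul_of_pos_right b hL) hnw
    refine ⟨fun E hE => hdead E (mem_filter.1 hE).1, hu.trans ?_⟩
    exact card_le_card hmn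
  -- (2) counts
  have hcount : #(univ.filter fun x : EdgeVec n => x ∈ S) * u ^ L ≤
      A₀ * Fintype.card (EdgeVec n) := by
    have h1 : #(univ.filter fun x : EdgeVec n => x ∈ S) ≤ #(univ.filter P) :=
      (card_le_card fun x hx => mem_filter.2 ⟨mem_univ _, hSP x (mem_filter.1 hx).2⟩).trans
        (card_filter_bool_le P)
    have h2 := pow_mul_card_minimal_ge_le D' (b * L + w) b L u (fun E hE => (mem_filter.1 hE).2)
    have h3 : Fintype.card (EdgeVec n) = 2 ^ Fintype.card (⊤ : SimpleGraph (Fin n)).edgeSet := by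
      rw [Fintype.card_fun, Fintype.card_bool]
    rw [h3, mul_comm]
    refine (Nat.mul_le_mul_left _ h1).trans (h2.trans_eq ?_)
    rw [hA₀, mul_comm]
  rw [erdosRenyiHalf_toOuterMeasure_eq_card_div]
  exact natCast_div_le_div_of_mul_le hcount Fintype.card_ne_zero (pow_pos hu L).ne'

/-! ### Wide terms missing few slots -/

/-- **Wide terms rarely miss few slots.** The noise points at which some term of `D` with `> W` slots misses `≤ B`
slots (`B ≤ W`) have probability `≤ #D · N^B · 2^{-(W-B)}`, `N` the number of slots: the missing slots lie in one of
the `C(#E, B) ≤ N^B` `B`-subsets `S` of the term `E`, and `E \ S` is all on. [folklore] -/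
theorem erdosRenyiHalf_wide_le (D : Finset (Finset (⊤ : SimpleGraph (Fin n)).edgeSet)) (W B : ℕ) (hBW : B ≤ W) :
    (erdosRenyiHalf n).toOuterMeasure
        {x | ∃ E ∈ D, W < #E ∧ #(E \ univ.filter fun e => x e = true) ≤ B} ≤
      (#D : ℝ≥0∞) * (((Fintype.card (⊤ : SimpleGraph (Fin n)).edgeSet) ^ B : ℕ) : ℝ≥0∞) * 2⁻¹ ^ (W - B) := by
  classical
  set P0 := erdosRenyiHalf n with hP0
  set N := Fintype.card (⊤ : SimpleGraph (Fin n)).edgeSet with hN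
  have hset : {x : EdgeVec n | ∃ E ∈ D, W < #E ∧ #(E \ univ.filter fun e => x e = true) ≤ B} =
      ⋃ E ∈ D, {x : EdgeVec n | W < #E ∧ #(E \ univ.filter fun e => x e = true) ≤ B} := by
    ext x; simp only [Set.mem_setOf_eq, Set.mem_iUnion, exists_prop]
  have hterm : ∀ E ∈ D, P0.toOuterMeasure {x : EdgeVec n | W < #E ∧ #(E \ univ.filter fun e => x e = true) ≤ B} ≤
      ((N ^ B : ℕ) : ℝ≥0∞) * 2⁻¹ ^ (W - B) := by
    intro E _
    by_cases hWE : W < #E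
    · have hBE : B ≤ #E := hBW.trans hWE.le
      have hcov : {x : EdgeVec n | W < #E ∧ #(E \ univ.filter fun e => x e = true) ≤ B} ⊆
          ⋃ S ∈ E.powersetCard B, {x : EdgeVec n | ∀ e ∈ E \ S, x e = true} := by
        intro x hx
        obtain ⟨-, hxB⟩ := hx
        obtain ⟨S, hMS, hSE, hScard⟩ := exists_subsuperset_card_eq
          (sdiff_subset : E \ univ.filter (fun e => x e = true) ⊆ E) hxB hBE
        refine Set.mem_biUnion (mem_powersetCard.2 ⟨hSE, hScard⟩) fun e he => ?_
        rw [Finset.mem_sdiff] at he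
        by_contra hxe
        exact he.2 (hMS (Finset.mem_sdiff.2 ⟨he.1, fun h => hxe (mem_filter.1 h).2⟩))
      calc P0.toOuterMeasure {x : EdgeVec n | W < #E ∧ #(E \ univ.filter fun e => x e = true) ≤ B}
          ≤ P0.toOuterMeasure (⋃ S ∈ E.powersetCard B, {x : EdgeVec n | ∀ e ∈ E \ S, x e = true}) :=
            P0.toOuterMeasure.mono hcov
        _ ≤ ∑ S ∈ E.powersetCard B, P0.toOuterMeasure {x : EdgeVec n | ∀ e ∈ E \ S, x e = true} :=
            MeasureTheory.measure_biUnion_finset_le _ _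
        _ ≤ ∑ _S ∈ E.powersetCard B, (2⁻¹ : ℝ≥0∞) ^ (W - B) := by
            refine sum_le_sum fun S hS => (erdosRenyiHalf_forall_eq_true_le _).trans ?_
            refine pow_le_pow_right_of_le_one' (ENNReal.inv_le_one.2 one_le_two) ?_
            rw [card_sdiff_of_subset (mem_powersetCard.1 hS).1, (mem_powersetCard.1 hS).2]
            omega
        _ = ((#E).choose B : ℝ≥0∞) * 2⁻¹ ^ (W - B) := by rw [sum_const, card_powersetCard, nsmul_eq_mul]
        _ ≤ ((N ^ B : ℕ) : ℝ≥0∞) * 2⁻¹ ^ (W - B) := by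
            gcongr
            exact_mod_cast (Nat.choose_le_pow _ _).trans (Nat.pow_le_pow_left (card_le_univ E) B)
    · have hempty : {x : EdgeVec n | W < #E ∧ #(E \ univ.filter fun e => x e = true) ≤ B} = ∅ := by
        ext x; simp [hWE]
      rw [hempty, MeasureTheory.measure_empty]
      exact bot_le
  rw [hset]
  calc P0.toOuterMeasure (⋃ E ∈ D, {x : EdgeVec n | W < #E ∧ #(E \ univ.filter fun e => x e = true) ≤ B})
      ≤ ∑ E ∈ D, P0.toOuterMeasure {x : EdgeVec n | W < #E ∧ #(E \ univ.filter fun e => x e = true) ≤ B} :=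
        MeasureTheory.measure_biUnion_finset_le _ _
    _ ≤ ∑ _E ∈ D, ((N ^ B : ℕ) : ℝ≥0∞) * 2⁻¹ ^ (W - B) := sum_le_sum hterm
    _ = _ := by rw [sum_const, nsmul_eq_mul, mul_assoc]

/-! ### Revival of a dead DNF by the planted clique -/

/-- **Revival bound.** Let `D` be dead at the noise point `x` (no term on) and let `N_b` be the number of its minimal
missing sets of size `≤ b`, where `b ≥ C(v₀ - 1, 2)` and `v₀ ≥ 2`. If the planted graph `x ∪ K_A` contains a term of
`D` then `A` covers the vertex set of a minimal missing set; one of size `≤ b` spans `≥ 2` vertices (probability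
`≤ d²/n²` each), one of size `> b` spans `≥ v₀` vertices (probability `≤ d^{v₀}/n^{v₀}`, at most `#D` of them). Hence
`Pr_A[D revived] ≤ N_b d²/n² + #D d^{v₀}/n^{v₀}` (`d = min k n`). [folklore] -/
theorem uniformKSubsets_revive_le (hn : 0 < n) (k b v₀ : ℕ) (hv₀ : 2 ≤ v₀) (hb : (v₀ - 1).choose 2 ≤ b)
    (D : Finset (Finset (⊤ : SimpleGraph (Fin n)).edgeSet)) (x : EdgeVec n)
    (hdead : ∀ E ∈ D, ¬ E ⊆ univ.filter fun e => x e = true) :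
    (PMF.uniformOfFinset (kSubsets n k) (kSubsets_nonempty n k)).toOuterMeasure
        {A | ∃ E ∈ D, ∀ e ∈ E, plant A x e = true} ≤
      ((#((D.image fun E => E \ univ.filter fun e => x e = true).filter fun F =>
            (∀ E ∈ D, E \ (univ.filter fun e => x e = true) ⊆ F →
              E \ (univ.filter fun e => x e = true) = F) ∧ #F ≤ b) * min k n ^ 2 : ℕ) : ℝ≥0∞) /
          ((n ^ 2 : ℕ) : ℝ≥0∞) +
        ((#D * min k n ^ v₀ : ℕ) : ℝ≥0∞) / ((n ^ v₀ : ℕ) : ℝ≥0∞) := by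
  classical
  set X := univ.filter fun e : (⊤ : SimpleGraph (Fin n)).edgeSet => x e = true with hX
  set d := min k n with hd
  set MF := (D.image fun E => E \ X).filter fun F => ∀ E ∈ D, E \ X ⊆ F → E \ X = F with hMF
  set V : Finset (⊤ : SimpleGraph (Fin n)).edgeSet → Finset (Fin n) := fun F =>
    univ.filter fun v : Fin n => ∃ e ∈ F, v ∈ (e : Sym2 (Fin n)) with hV
  have hdn : d ≤ n := min_le_right k n
  have hne := card_kSubsets_cast_ne_zero n k
  have htop : ((#(kSubsets n k) : ℕ) : ℝ≥0∞) ≠ ⊤ := ENNReal.natCast_ne_top _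
  -- (1) a reviving `A` covers the vertices of a minimal missing set
  have hcov : ∀ A ∈ kSubsets n k, (∃ E ∈ D, ∀ e ∈ E, plant A x e = true) →
      A ∈ MF.biUnion fun F => (kSubsets n k).filter fun A => V F ⊆ A := by
    intro A hAKS hA
    obtain ⟨E, hED, hEA⟩ := hA
    obtain ⟨F, hFimg, hFmin, hFsub⟩ := exists_minimal_missing_subset D X hED
    rw [mem_biUnion]
    refine ⟨F, mem_filter.2 ⟨mem_image.2 hFimg, hFmin⟩, mem_filter.2 ⟨hAKS, fun v hv => ?_⟩⟩
    rw [hV, mem_filter] at hv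
    obtain ⟨e, heF, hve⟩ := hv.2
    have heEX := Finset.mem_sdiff.1 (hFsub heF)
    have hxe : ¬ x e = true := fun h => heEX.2 (mem_filter.2 ⟨mem_univ _, h⟩)
    rcases (plant_apply_eq_true_iff A x e).1 (hEA e heEX.1) with h | h
    · exact absurd h hxe
    · exact h v hve
  -- (2) a fixed vertex set is covered with probability `≤ (d/n)^{#V}`
  have hF : ∀ F ∈ MF, ((#((kSubsets n k).filter fun A => V F ⊆ A) : ℕ) : ℝ≥0∞) ≤
      ((#(kSubsets n k) : ℕ) : ℝ≥0∞) * (((d ^ #(V F) : ℕ) : ℝ≥0∞) / ((n ^ #(V F) : ℕ) : ℝ≥0∞)) := by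
    intro F _
    have h := card_kSubsets_filter_superset_mul_le (V F) k
    have hnv : ((n ^ #(V F) : ℕ) : ℝ≥0∞) ≠ 0 := by exact_mod_cast (pow_pos hn _).ne'
    rw [← mul_div_assoc, ENNReal.le_div_iff_mul_le (Or.inl hnv) (Or.inl (ENNReal.natCast_ne_top _))]
    exact_mod_cast h
  -- (3) vertex counts of minimal missing sets
  have hV2 : ∀ F ∈ MF, 2 ≤ #(V F) := by
    intro F hFM
    obtain ⟨E, hED, hEF⟩ := mem_image.1 (mem_filter.1 hFM).1
    obtain ⟨e, he⟩ : F.Nonempty := by rw [← hEF]; exact Finset.sdiff_nonempty.2 (hdead E hED)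
    calc 2 = #(univ.filter fun v : Fin n => v ∈ (e : Sym2 (Fin n))) := (card_filter_mem_edge e).symm
      _ ≤ #(V F) := card_le_card fun v hv => by
          rw [mem_filter] at hv
          exact mem_filter.2 ⟨mem_univ _, e, he, hv.2⟩
  have hVv : ∀ F ∈ MF, b < #F → v₀ ≤ #(V F) := by
    intro F _ hbF
    have hFV : #F ≤ (#(V F)).choose 2 := by
      have h := card_filter_inside_le_choose (univ : Finset (Fin n)) F
      rw [filter_true_of_mem (fun e _ v _ => mem_univ v), univ_inter] at h
      exact h
    by_contra hlt
    have hle : #(V F) ≤ v₀ - 1 := by omega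
    have := (hbF.trans_le hFV).trans_le ((Nat.choose_le_choose 2 hle).trans hb)
    exact lt_irrefl _ this
  have hfrac : ∀ F ∈ MF, ∀ a, a ≤ #(V F) →
      ((d ^ #(V F) : ℕ) : ℝ≥0∞) / ((n ^ #(V F) : ℕ) : ℝ≥0∞) ≤ ((d ^ a : ℕ) : ℝ≥0∞) / ((n ^ a : ℕ) : ℝ≥0∞) :=
    fun F _ a ha => natCast_div_le_div_of_mul_le (pow_mul_pow_le_of_le hdn ha) (pow_pos hn _).ne' (pow_pos hn _).ne'
  -- (4) assemble
  have hbig : #(MF.filter fun F => ¬ #F ≤ b) ≤ #D :=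
    calc #(MF.filter fun F => ¬ #F ≤ b) ≤ #MF := card_le_card (filter_subset _ _)
      _ ≤ #(D.image fun E => E \ X) := card_le_card (filter_subset _ _)
      _ ≤ #D := card_image_le
  rw [PMF.toOuterMeasure_uniformOfFinset_apply, Nat.cast_mul, Nat.cast_mul, mul_div_assoc, mul_div_assoc]
  -- (the filter of `toOuterMeasure_uniformOfFinset_apply` carries a classical instance: `(_)` below)
  refine le_trans (ENNReal.div_le_div_right (Nat.cast_le.2 (card_le_card
    (t := MF.biUnion fun F => (kSubsets n k).filter fun A => V F ⊆ A) ?sub)) _) ?_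
  case sub =>
    intro A hA
    have hA' := (@Finset.mem_filter _ _ (_) _ _).1 hA
    exact hcov A hA'.1 hA'.2
  calc ((#(MF.biUnion fun F => (kSubsets n k).filter fun A => V F ⊆ A) : ℕ) : ℝ≥0∞) /
          ((#(kSubsets n k) : ℕ) : ℝ≥0∞)
      ≤ (∑ F ∈ MF, ((#((kSubsets n k).filter fun A => V F ⊆ A) : ℕ) : ℝ≥0∞)) /
          ((#(kSubsets n k) : ℕ) : ℝ≥0∞) :=
        ENNReal.div_le_div_right (by exact_mod_cast card_biUnion_le) _
    _ ≤ (∑ F ∈ MF, ((#(kSubsets n k) : ℕ) : ℝ≥0∞) * (((d ^ #(V F) : ℕ) : ℝ≥0∞) / ((n ^ #(V F) : ℕ) : ℝ≥0∞))) /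
          ((#(kSubsets n k) : ℕ) : ℝ≥0∞) :=
        ENNReal.div_le_div_right (sum_le_sum fun F hFM => hF F hFM) _
    _ = ∑ F ∈ MF, ((d ^ #(V F) : ℕ) : ℝ≥0∞) / ((n ^ #(V F) : ℕ) : ℝ≥0∞) := by
        rw [← mul_sum, mul_comm, mul_div_assoc, ENNReal.div_self hne htop, mul_one]
    _ = (∑ F ∈ MF.filter (fun F => #F ≤ b), ((d ^ #(V F) : ℕ) : ℝ≥0∞) / ((n ^ #(V F) : ℕ) : ℝ≥0∞)) +
          ∑ F ∈ MF.filter (fun F => ¬ #F ≤ b), ((d ^ #(V F) : ℕ) : ℝ≥0∞) / ((n ^ #(V F) : ℕ) : ℝ≥0∞) :=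
        (sum_filter_add_sum_filter_not _ _ _).symm
    _ ≤ (∑ _F ∈ MF.filter (fun F => #F ≤ b), ((d ^ 2 : ℕ) : ℝ≥0∞) / ((n ^ 2 : ℕ) : ℝ≥0∞)) +
          ∑ _F ∈ MF.filter (fun F => ¬ #F ≤ b), ((d ^ v₀ : ℕ) : ℝ≥0∞) / ((n ^ v₀ : ℕ) : ℝ≥0∞) := by
        refine add_le_add (sum_le_sum fun F hF1 => ?_) (sum_le_sum fun F hF2 => ?_)
        · exact hfrac F (mem_filter.1 hF1).1 2 (hV2 F (mem_filter.1 hF1).1)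
        · exact hfrac F (mem_filter.1 hF2).1 v₀
            (hVv F (mem_filter.1 hF2).1 (not_le.1 (mem_filter.1 hF2).2))
    _ = (#(MF.filter fun F => #F ≤ b) : ℝ≥0∞) * (((d ^ 2 : ℕ) : ℝ≥0∞) / ((n ^ 2 : ℕ) : ℝ≥0∞)) +
          (#(MF.filter fun F => ¬ #F ≤ b) : ℝ≥0∞) * (((d ^ v₀ : ℕ) : ℝ≥0∞) / ((n ^ v₀ : ℕ) : ℝ≥0∞)) := by
        rw [sum_const, sum_const, nsmul_eq_mul, nsmul_eq_mul]
    _ ≤ (#(MF.filter fun F => #F ≤ b) : ℝ≥0∞) * (((d ^ 2 : ℕ) : ℝ≥0∞) / ((n ^ 2 : ℕ) : ℝ≥0∞)) +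
          (#D : ℝ≥0∞) * (((d ^ v₀ : ℕ) : ℝ≥0∞) / ((n ^ v₀ : ℕ) : ℝ≥0∞)) := by
        gcongr
    _ = _ := by rw [hMF, filter_filter]

/-! ### The per-`n` bound -/

/-- **Per-`n` bound for an AND of monotone DNFs under the planted-clique pair.** For `m` term families `𝓓 i` with
`≤ s` terms each, clique size `k` (`d = min k n`), count threshold `u`, width slack `w`, size cutoff `b ≥ C(v₀-1,2)`
(`v₀ ≥ 2`) and moment `L ≥ 1`:
`Pr_planted[∀ i, 𝓓 i fires] ≤ u d²/n² + s d^{v₀}/n^{v₀} + Pr_null[∀ i, 𝓓 i fires] + m (A₀/u^L + s N^{bL} 2^{-w})`.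
Proof: `stub_plantingBound` with the bad noise set "accepted, or some `𝓓 i` is in the tail event or has a wide term
missing few slots"; off it, a dead `𝓓 i` has `< u` small minimal missing sets and `uniformKSubsets_revive_le` applies.
[folklore] -/
theorem andDnf_planted_le (hn : 0 < n) (k u w b v₀ L : ℕ) (hv₀ : 2 ≤ v₀) (hb : (v₀ - 1).choose 2 ≤ b)
    (hL : 1 ≤ L) {m : ℕ} (𝓓 : Fin m → Finset (Finset (⊤ : SimpleGraph (Fin n)).edgeSet)) (s : ℕ)
    (hs : ∀ i, #(𝓓 i) ≤ s) :
    (plantedCliqueDist n k).toOuterMeasure {x | ∀ i, ∃ E ∈ 𝓓 i, ∀ e ∈ E, x e = true} ≤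
      ((u * min k n ^ 2 : ℕ) : ℝ≥0∞) / ((n ^ 2 : ℕ) : ℝ≥0∞) +
          ((s * min k n ^ v₀ : ℕ) : ℝ≥0∞) / ((n ^ v₀ : ℕ) : ℝ≥0∞) +
        ((erdosRenyiHalf n).toOuterMeasure {x | ∀ i, ∃ E ∈ 𝓓 i, ∀ e ∈ E, x e = true} +
          (m : ℝ≥0∞) * ((((2 ^ (b * L) * (b * L + w) + 1) ^ (b * L) * 2 ^ (b * L * L) : ℕ) : ℝ≥0∞) /
              ((u ^ L : ℕ) : ℝ≥0∞) +
            (s : ℝ≥0∞) * (((Fintype.card (⊤ : SimpleGraph (Fin n)).edgeSet) ^ (b * L) : ℕ) : ℝ≥0∞) *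
              2⁻¹ ^ w)) := by
  set P0 := erdosRenyiHalf n with hP0
  set d := min k n with hd
  set A₀ := (2 ^ (b * L) * (b * L + w) + 1) ^ (b * L) * 2 ^ (b * L * L) with hA₀
  set N := Fintype.card (⊤ : SimpleGraph (Fin n)).edgeSet with hN
  -- events
  set Acc : Set (EdgeVec n) := {x | ∀ i, ∃ E ∈ 𝓓 i, ∀ e ∈ E, x e = true} with hAcc
  set Tail : Fin m → Set (EdgeVec n) := fun i => {x |
      (∀ E ∈ 𝓓 i, ¬ E ⊆ univ.filter fun e => x e = true) ∧
      (∀ E ∈ 𝓓 i, b * L + w < #E → b * L < #(E \ univ.filter fun e => x e = true)) ∧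
      u ≤ #(((𝓓 i).image fun E => E \ univ.filter fun e => x e = true).filter fun F =>
        (∀ E ∈ 𝓓 i, E \ (univ.filter fun e => x e = true) ⊆ F →
          E \ (univ.filter fun e => x e = true) = F) ∧ #F ≤ b)} with hTail
  set Wide : Fin m → Set (EdgeVec n) := fun i =>
    {x | ∃ E ∈ 𝓓 i, b * L + w < #E ∧ #(E \ univ.filter fun e => x e = true) ≤ b * L} with hWide
  set η : ℝ≥0∞ := ((u * d ^ 2 : ℕ) : ℝ≥0∞) / ((n ^ 2 : ℕ) : ℝ≥0∞) +
      ((s * d ^ v₀ : ℕ) : ℝ≥0∞) / ((n ^ v₀ : ℕ) : ℝ≥0∞) with hη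
  -- (1) the planting bound with bad noise set `Acc ∪ ⋃ i, (Tail i ∪ Wide i)`
  have key := stub_plantingBound n k (fun y => decide (∀ i, ∃ E ∈ 𝓓 i, ∀ e ∈ E, y e = true)) η
    (Acc ∪ ⋃ i, (Tail i ∪ Wide i)) ?_
  · have hf : {y : EdgeVec n | decide (∀ i, ∃ E ∈ 𝓓 i, ∀ e ∈ E, y e = true) = true} = Acc := by
      ext y; simp [hAcc]
    rw [hf] at key
    refine key.trans (add_le_add le_rfl ?_)
    calc P0.toOuterMeasure (Acc ∪ ⋃ i, (Tail i ∪ Wide i))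
        ≤ P0.toOuterMeasure Acc + P0.toOuterMeasure (⋃ i, (Tail i ∪ Wide i)) :=
          MeasureTheory.measure_union_le _ _
      _ ≤ P0.toOuterMeasure Acc + ∑ i, P0.toOuterMeasure (Tail i ∪ Wide i) :=
          add_le_add le_rfl (MeasureTheory.measure_iUnion_fintype_le _ _)
      _ ≤ P0.toOuterMeasure Acc + ∑ i, (P0.toOuterMeasure (Tail i) + P0.toOuterMeasure (Wide i)) :=
          add_le_add le_rfl (sum_le_sum fun i _ => MeasureTheory.measure_union_le _ _)
      _ ≤ P0.toOuterMeasure Acc + ∑ _i : Fin m, (((A₀ : ℕ) : ℝ≥0∞) / ((u ^ L : ℕ) : ℝ≥0∞) +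
            (s : ℝ≥0∞) * ((N ^ (b * L) : ℕ) : ℝ≥0∞) * 2⁻¹ ^ w) := by
          refine add_le_add le_rfl (sum_le_sum fun i _ => add_le_add ?_ ?_)
          · exact erdosRenyiHalf_minimal_tail_le (𝓓 i) w b L u hL
          · calc P0.toOuterMeasure (Wide i)
                ≤ (#(𝓓 i) : ℝ≥0∞) * ((N ^ (b * L) : ℕ) : ℝ≥0∞) * 2⁻¹ ^ (b * L + w - b * L) :=
                  erdosRenyiHalf_wide_le (𝓓 i) (b * L + w) (b * L) (Nat.le_add_right _ _)
              _ ≤ (s : ℝ≥0∞) * ((N ^ (b * L) : ℕ) : ℝ≥0∞) * 2⁻¹ ^ w := by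
                  rw [Nat.add_sub_cancel_left]
                  gcongr
                  exact_mod_cast hs i
      _ = _ := by rw [sum_const, card_univ, Fintype.card_fin, nsmul_eq_mul]
  · -- (2) off the bad set, the revival probability is `≤ η`
    intro x hx
    simp only [Set.mem_union, Set.mem_iUnion, not_or, not_exists] at hx
    obtain ⟨hxAcc, hxTW⟩ := hx
    -- a dead index
    have h1 : ¬ ∀ i, ∃ E ∈ 𝓓 i, ∀ e ∈ E, x e = true := fun h => hxAcc (by rw [hAcc]; exact h)
    push Not at h1
    obtain ⟨i, hi⟩ := h1
    have hdead : ∀ E ∈ 𝓓 i, ¬ E ⊆ univ.filter fun e => x e = true := by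
      intro E hE hsub
      obtain ⟨e, he, hxe⟩ := hi E hE
      exact hxe (mem_filter.1 (hsub he)).2
    obtain ⟨hxT, hxW⟩ := hxTW i
    have hnw : ∀ E ∈ 𝓓 i, b * L + w < #E → b * L < #(E \ univ.filter fun e => x e = true) := by
      intro E hE hwE
      by_contra hle
      exact hxW (by simp only [hWide, Set.mem_setOf_eq]; exact ⟨E, hE, hwE, not_lt.1 hle⟩)
    have hNu : #(((𝓓 i).image fun E => E \ univ.filter fun e => x e = true).filter fun F =>
        (∀ E ∈ 𝓓 i, E \ (univ.filter fun e => x e = true) ⊆ F →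
          E \ (univ.filter fun e => x e = true) = F) ∧ #F ≤ b) < u := by
      by_contra hge
      exact hxT (by simp only [hTail, Set.mem_setOf_eq]; exact ⟨hdead, hnw, not_lt.1 hge⟩)
    calc (PMF.uniformOfFinset (kSubsets n k) (kSubsets_nonempty n k)).toOuterMeasure
          {A | (fun y => decide (∀ i, ∃ E ∈ 𝓓 i, ∀ e ∈ E, y e = true)) (plant A x) = true}
        ≤ (PMF.uniformOfFinset (kSubsets n k) (kSubsets_nonempty n k)).toOuterMeasure
            {A | ∃ E ∈ 𝓓 i, ∀ e ∈ E, plant A x e = true} := by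
          refine (PMF.toOuterMeasure _).mono fun A hA => ?_
          rw [Set.mem_setOf_eq, decide_eq_true_eq] at hA
          exact hA i
      _ ≤ _ := uniformKSubsets_revive_le hn k b v₀ hv₀ hb (𝓓 i) x hdead
      _ ≤ η := by
          rw [hη]
          exact add_le_add
            (ENNReal.div_le_div_right (by exact_mod_cast Nat.mul_le_mul_right _ hNu.le) _)
            (ENNReal.div_le_div_right (by exact_mod_cast Nat.mul_le_mul_right _ (hs i)) _)

/-! ### The registered helper stub -/

/-- **stub_blindAndDnfBound** (registered helper stub of `stub_blindAndDnf`, crux stmt-PneNP-18027): the per-`n`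
bound `andDnf_planted_le` (planted `≤ u d²/n² + s d^{v₀}/n^{v₀} + null + m (A₀/u^L + s N^{bL} 2^{-w})`). [folklore] -/
theorem stub_blindAndDnfBound :
    ∀ {n : ℕ}, 0 < n → ∀ (k u w b v₀ L : ℕ), 2 ≤ v₀ → (v₀ - 1).choose 2 ≤ b → 1 ≤ L → ∀ {m : ℕ} (𝓓 : Fin m →
    Finset (Finset ((⊤ : SimpleGraph (Fin n)).edgeSet))) (s : ℕ), (∀ i, #(𝓓 i) ≤ s) → (plantedCliqueDist n
    k).toOuterMeasure {x | ∀ i, ∃ E ∈ 𝓓 i, ∀ e ∈ E, x e = true} ≤ ((u * min k n ^ 2 : ℕ) : ℝ≥0∞) / ((n ^ 2 : ℕ)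
    : ℝ≥0∞) + ((s * min k n ^ v₀ : ℕ) : ℝ≥0∞) / ((n ^ v₀ : ℕ) : ℝ≥0∞) + ((erdosRenyiHalf n).toOuterMeasure {x |
    ∀ i, ∃ E ∈ 𝓓 i, ∀ e ∈ E, x e = true} + (m : ℝ≥0∞) * ((((2 ^ (b * L) * (b * L + w) + 1) ^ (b * L) * 2 ^ (b *
    L * L) : ℕ) : ℝ≥0∞) / ((u ^ L : ℕ) : ℝ≥0∞) + (s : ℝ≥0∞) * (((Fintype.card ((⊤ : SimpleGraph (Fin
    n)).edgeSet)) ^ (b * L) : ℕ) : ℝ≥0∞) * 2⁻¹ ^ w)) :=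
  fun hn k u w b v₀ L hv₀ hb hL _ 𝓓 s hs => andDnf_planted_le hn k u w b v₀ L hv₀ hb hL 𝓓 s hs

end Summit.PneNP.PneNP.Theorems.MonotoneBlind.VertexCover
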